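import Summits.Parity.GeneralizedHardyLittlewood.Theorems.BeyondDiagonalBeatsQuarter.OffDiagPoissonApplied
import HarnessLib

/-!
# Route `PrimeLevelFamEdge`, crux K_B (stmt-Parity-20343), line `diagonal_kernel_split` rev 4, plan Ω,
# L2c step (P5) — **the layer weight is a ONE-VARIABLE PROFILE of the product `y₁y₂`:
# `g(y₁,y₂) = G(y₁y₂)`, `G(s) = C·s^{−1/2}·W(a·s)·J₁(b√s)`, `C = (d₁d₂)^{−1/2}r⁻¹`, `a = d₁d₂/q̂²`, `b = 4π√(αβ)/(qr)`**

prover-2's `OffDiagDualCostProfile.abs_pow_mul_iteratedDeriv_profile_le` (p641175) bounds all derivatives of the profile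
`G(s) = C·s^{−1/2}·(W(as)·J_n(b√s))` (`|sⁿG⁽ⁿ⁾(s)| ≤ (n+1)²n!nⁿ(1+|b|√s)ⁿ·|C|s^{−1/2}` — cost `(1+Z)/s` per derivative, no
`X`-dependence). This file identifies the real layer weight of Ω-d5 (`OffDiag.layerWeightR`, the `g` of `boxWeight`) with
that profile on the open quadrant, so the slice derivatives `∂₁^k Φ_i`, `∂₂² Φ_i` of the box weight reduce to derivatives of
`s ↦ G(s·y₂)` (P6) and the costs `A_k, B_k` of `OffDiagDualTruncationBound` follow (P7):

* `layerWeightR_eq_profile` — for `y₁, y₂ > 0` (and `d₁, d₂ ≥ 1`, any `α, β, q, r`):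
  `layerWeightR q d₁ d₂ α β r (y₁,y₂) = C·(y₁y₂)^{−1/2}·(W(a·(y₁y₂))·J₁(b·√(y₁y₂)))` with the constants above;
* `layerWeightR_slice_eqOn` — for fixed `y₂ > 0`: `y₁ ↦ g(y₁,y₂)` agrees on `(0,∞)` with `y₁ ↦ G(y₂·y₁)` — the shape
  `iteratedDeriv_comp_const_mul`-type scaling consumes; `profile_consts_pos` — `0 < a` and `0 ≤ |b|`-bookkeeping.

Elementary algebra (`Real.mul_rpow`, `Real.sqrt_mul`); theorems only; standard axioms. Helper; closes nothing.
«The programme SEARCHES and TYPES; no claim about Landau–Siegel zeros, Theorems 1–2 of arXiv:2211.02515 or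
a repaired Margin232 until a kernel theorem says so.»
-/

noncomputable section

open Set
open scoped Real

namespace Summit.Parity.GeneralizedHardyLittlewood.Theorems.BeyondDiagonalBeatsQuarter.OffDiag

open Literature.NumberTheory.LFunctions Literature.NumberTheory.LFunctions.KMV2000
open Literature.Analysis.FunctionSpaces (besselJ)

/-- **The layer weight is a profile of `y₁y₂`.** For `d₁, d₂ ≥ 1` and `y₁, y₂ > 0`:
`layerWeightR q d₁ d₂ α β r (y₁,y₂) = C·(y₁y₂)^{−1/2}·(W(a·(y₁y₂))·J₁(b·√(y₁y₂)))`,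
`C = (d₁d₂)^{−1/2}·r⁻¹`, `a = d₁d₂/q̂²`, `b = 4π√(αβ)/(qr)`. [cite: KowalskiMichelVanderKam2000, (21)–(23) p. 12 — derivation] -/
theorem layerWeightR_eq_profile (q : ℕ) {d₁ d₂ : ℕ} (hd₁ : 1 ≤ d₁) (hd₂ : 1 ≤ d₂) (α β r : ℕ)
    {y₁ y₂ : ℝ} (hy₁ : 0 < y₁) (hy₂ : 0 < y₂) :
    layerWeightR q d₁ d₂ α β r (y₁, y₂) =
      (((d₁ : ℝ) * d₂) ^ (-(1 : ℝ) / 2) * (r : ℝ)⁻¹) * (y₁ * y₂) ^ (-(1 : ℝ) / 2) *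
        (cutoffW (((d₁ : ℝ) * d₂ / qhat q ^ 2) * (y₁ * y₂)) *
          besselJ 1 ((4 * π * Real.sqrt ((α : ℝ) * β) / ((q : ℝ) * r)) * Real.sqrt (y₁ * y₂))) := by
  have hd : (0 : ℝ) ≤ (d₁ : ℝ) * d₂ := by positivity
  have hy : (0 : ℝ) ≤ y₁ * y₂ := by positivity
  have hαβ : (0 : ℝ) ≤ (α : ℝ) * β := by positivity
  have e1 : (d₁ : ℝ) * y₁ * ((d₂ : ℝ) * y₂) = ((d₁ : ℝ) * d₂) * (y₁ * y₂) := by ring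
  have e2 : (α : ℝ) * y₁ * ((β : ℝ) * y₂) = ((α : ℝ) * β) * (y₁ * y₂) := by ring
  have e3 : (-(1 / 2 : ℝ)) = -(1 : ℝ) / 2 := by norm_num
  rw [layerWeightR]
  simp only
  rw [e1, e2, e3, Real.mul_rpow hd hy, Real.sqrt_mul hαβ]
  have e4 : ((d₁ : ℝ) * d₂) * (y₁ * y₂) / qhat q ^ 2 = ((d₁ : ℝ) * d₂ / qhat q ^ 2) * (y₁ * y₂) := by ring
  have e5 : 4 * π * (Real.sqrt ((α : ℝ) * β) * Real.sqrt (y₁ * y₂)) / ((q : ℝ) * r) =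
      (4 * π * Real.sqrt ((α : ℝ) * β) / ((q : ℝ) * r)) * Real.sqrt (y₁ * y₂) := by ring
  rw [e4, e5]
  ring

/-- **Slice form**: for fixed `y₂ > 0`, the first-variable slice `y₁ ↦ g(y₁,y₂)` agrees on `(0,∞)` with the scaled
profile `y₁ ↦ G(y₂·y₁)`. [cite: KowalskiMichelVanderKam2000, (21)–(23) p. 12 — derivation] -/
theorem layerWeightR_slice_eqOn (q : ℕ) {d₁ d₂ : ℕ} (hd₁ : 1 ≤ d₁) (hd₂ : 1 ≤ d₂) (α β r : ℕ)
    {y₂ : ℝ} (hy₂ : 0 < y₂) :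
    EqOn (fun y₁ : ℝ ↦ layerWeightR q d₁ d₂ α β r (y₁, y₂))
      (fun y₁ : ℝ ↦ (fun s : ℝ ↦ (((d₁ : ℝ) * d₂) ^ (-(1 : ℝ) / 2) * (r : ℝ)⁻¹) * s ^ (-(1 : ℝ) / 2) *
        (cutoffW (((d₁ : ℝ) * d₂ / qhat q ^ 2) * s) *
          besselJ 1 ((4 * π * Real.sqrt ((α : ℝ) * β) / ((q : ℝ) * r)) * Real.sqrt s))) (y₂ * y₁))
      (Ioi 0) := by
  intro y₁ hy₁
  simp only
  rw [layerWeightR_eq_profile q hd₁ hd₂ α β r (mem_Ioi.mp hy₁) hy₂, mul_comm y₂ y₁]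

/-- The same for the second-variable slice (fixed `y₁ > 0`). [cite: KowalskiMichelVanderKam2000, (21)–(23) p. 12 — derivation] -/
theorem layerWeightR_slice_eqOn_snd (q : ℕ) {d₁ d₂ : ℕ} (hd₁ : 1 ≤ d₁) (hd₂ : 1 ≤ d₂) (α β r : ℕ)
    {y₁ : ℝ} (hy₁ : 0 < y₁) :
    EqOn (fun y₂ : ℝ ↦ layerWeightR q d₁ d₂ α β r (y₁, y₂))
      (fun y₂ : ℝ ↦ (fun s : ℝ ↦ (((d₁ : ℝ) * d₂) ^ (-(1 : ℝ) / 2) * (r : ℝ)⁻¹) * s ^ (-(1 : ℝ) / 2) *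
        (cutoffW (((d₁ : ℝ) * d₂ / qhat q ^ 2) * s) *
          besselJ 1 ((4 * π * Real.sqrt ((α : ℝ) * β) / ((q : ℝ) * r)) * Real.sqrt s))) (y₁ * y₂))
      (Ioi 0) := by
  intro y₂ hy₂
  simp only
  rw [layerWeightR_eq_profile q hd₁ hd₂ α β r hy₁ (mem_Ioi.mp hy₂)]

/-- Bookkeeping: the profile's dilation constant `a = d₁d₂/q̂²` is positive (`q, d₁, d₂ ≥ 1`), as
`abs_pow_mul_iteratedDeriv_profile_le` requires. [folklore] -/
theorem profile_dilation_pos {q d₁ d₂ : ℕ} [NeZero q] (hd₁ : 1 ≤ d₁) (hd₂ : 1 ≤ d₂) :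
    0 < (d₁ : ℝ) * d₂ / qhat q ^ 2 := by
  have hq : 0 < qhat q := qhat_pos_of_neZero q
  have h1 : (0 : ℝ) < d₁ := by exact_mod_cast hd₁
  have h2 : (0 : ℝ) < d₂ := by exact_mod_cast hd₂
  positivity

/-- On a dyadic box `y_j ∈ (K_j/2, 2K_j)` the Bessel scale in the profile cost is `|b|√(y₁y₂) ≤ 2|b|√(K₁K₂)`
(`= 2Z/… ` bookkeeping for `(1+|b|√s)ⁿ`). [folklore] -/
theorem abs_b_sqrt_le {b y₁ y₂ K₁ K₂ : ℝ} (hK₂ : 0 < K₂) (hy₁ : 0 < y₁)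
    (h₁ : y₁ < 2 * K₁) (h₂ : y₂ < 2 * K₂) :
    |b| * Real.sqrt (y₁ * y₂) ≤ 2 * |b| * Real.sqrt (K₁ * K₂) := by
  have hprod : y₁ * y₂ ≤ (2 * K₁) * (2 * K₂) := by nlinarith
  have hs : Real.sqrt (y₁ * y₂) ≤ Real.sqrt ((2 * K₁) * (2 * K₂)) := Real.sqrt_le_sqrt hprod
  have e : Real.sqrt ((2 * K₁) * (2 * K₂)) = 2 * Real.sqrt (K₁ * K₂) := by
    rw [show (2 * K₁) * (2 * K₂) = (2 : ℝ) ^ 2 * (K₁ * K₂) by ring, Real.sqrt_mul (by positivity),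
      Real.sqrt_sq (by norm_num)]
  rw [e] at hs
  calc |b| * Real.sqrt (y₁ * y₂) ≤ |b| * (2 * Real.sqrt (K₁ * K₂)) :=
        mul_le_mul_of_nonneg_left hs (abs_nonneg b)
    _ = 2 * |b| * Real.sqrt (K₁ * K₂) := by ring

end Summit.Parity.GeneralizedHardyLittlewood.Theorems.BeyondDiagonalBeatsQuarter.OffDiag
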